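/-
Origin: expansion seat `planner-pub-hodgecm-pv02-g8-0`, handover #2 2026-08-18T14:50:23Z (md5 56ebf223614e83b68e97051c9079379e, 280 l., 15 decls; NEW additive KERNEL leaf; imports my #1 ONLY => ONE rewrite `import Pv02g8.WeilThetaModelDerivCalculus` -> `import HodgeCM.Automorphic.WeilThetaModelDerivCalculus` (generic rule ^import Pv[0-9]+g[0-9]+\. -> HodgeCM.Automorphic. for this file); land AFTER my #1 (6dd90978); HOLD iff #1 held; independent of every other R (`HOME/pub-hodgecm-pv02-g8/lean/Pv02g8/WeilThetaModelDerivTransport.lean`, md5 56ebf223, 280 lines);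
landed by the gen-8 packager in gate run 31 as `HodgeCM/Automorphic/WeilThetaModelDerivTransport.lean` (import ^import Pv02g8\.WeilThetaModelDerivCalculus[ \t]*$→import HodgeCM.Automorphic.WeilThetaModelDerivCalculus ×1).
-/
/-
Copyright (c) 2026. All rights reserved.
Released under Apache 2.0 license as described in the file LICENSE.
Origin: pub-hodgecm-pv02-g8 (DAG-node prover #02, gen 8), file #2; target
`HodgeCM/Automorphic/WeilThetaModelDerivTransport.lean` (namespaces `HodgeCM.WeilThetaModel`,
`HodgeCM.SchwartzWeil(.Heis / .HeisenbergKernel)`).  NEW ADDITIVE LEAF — nothing landed or queued is replaced or edited.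
-/
import Summits.HodgeConjecture.HodgeCM.Automorphic.WeilThetaModelDerivCalculus_2

/-!
# Transport of Weil-topology derivatives along equivariance and conjugation

KERNEL leaf of lane (A) (linear / smooth structure of Weil theta models).  Zero unproved declarations, no new
constants, no cited hypothesis; Mathlib + the package only.

## What this file is for

The ninth field `smooth` of the seam-S4 analytic side ([SETUP D5′]; `ArchC.LinSmoothSide.smooth`,
`HOME/pub-hodgecm-pv11-g9/ENDSTATE-S4-SPEC.md` §1; pv06-g7's reduced record `ArchC.HypSmoothSide`) asks, for chosen
real directions `X_j` (curves `e_j`, intended `exp(sX_j)`) and every pure tensor `ins f φ = φ ⊗ Φ_f`, that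
`s ↦ ω(e_j s)(ins f φ)` be differentiable in Weil's topology with derivative `ins f (XR j φ)`.  Directions and data come
in families related by the group: at a place `b ∈ Σ₁₂` the compact torus `T_b` rotates the plane `𝔭_b ⊂ 𝔲(W_b) ≅ 𝔲(1,1)`
of non-torus directions (`𝔭_b = Ad(T_b)·ℝX₁`) and acts on pure tensors through the equivariance field
`omg_ins : ω(ι_T t)(ins f φ) = ins f (ω_T t φ)` ([SETUP D4]); two finite data `Φ_f`, `ω_f(h)Φ_f` are related by an
element commuting with the archimedean one-parameter subgroups.

This file records, on an abstract linear Weil theta model `M` (`[M.LinearStr]`), that `HasSKDerivAt` statements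
TRANSPORT along such relations (§2, `hasSKDerivAt_omg_transport`): if
* `ω(k) ∘ ins₀ = ins₁ ∘ A` and `ω(k') ∘ ins₁ = ins₀ ∘ A'` for two "insertion" maps `ins₀ : F₀ → 𝒮^κ`, `ins₁ : F₁ → 𝒮^κ`
  and two group elements `k, k'` (ANY types `F₀, F₁`, ANY maps — linearity is not used),
* the curve `e` is conjugate to the curve `a` in the sense `ω(e s) = ω(k) ∘ ω(a s) ∘ ω(k')` on `𝒮^κ` (for `e s = k a(s) k'`
  this is multiplicativity of `ω` on the elements concerned, cf. `HeisenbergKernel.centerModel_omg_mul`),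
* `s ↦ ω(a s)(ins₀ ψ)` has `SK`-derivative `ins₀ (D ψ)` at `s₀` for EVERY `ψ : F₀`,
then `s ↦ ω(e s)(ins₁ φ)` has `SK`-derivative `ins₁ (A (D (A' φ)))` at `s₀` for every `φ : F₁`; with a rescaled
parameter (`e s` conjugate to `a (c s)`) the derivative is `c • ins₁ (A (D (A' φ)))` (chain rule of file #1).
So once the Schwartz-topology derivative is known along ONE curve on ONE insertion, it is known along every conjugate
curve and on every equivariantly related insertion, with the derivative map conjugated accordingly.  §3 states the
literal `smooth`-clause form (`((s:ℝ):ℂ)⁻¹ • (… - …)`, pv02-g7 `hasSKDerivAt_zero_iff_tendsto_coe_smul`).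
(Positioning: pv06-g7's `ArchCHyperbolic` shows by a Fock-side triangularity argument that ONE hyperbolic direction per
`Σ₁₂` place already suffices for the generation property `gen`; transport is the complementary remark for consumers
who keep a direction family spanning `𝔭_b` — pv11-g9's `LinSmoothSide` format with `ladder_span` — or several finite
data: the extra clauses cost nothing beyond the first.)

§4 is the concrete, unconditional instance on the centre model `centerModel V L m Γz hΓz` (`G = Heis V` acting on
`𝓢(V, ℂ)` by the Schrödinger representation `ρ_m`): the commutation / conjugation law of one-parameter subgroups of the
Heisenberg group, `k γ_{a,b,c}(s) = γ_{a,b,c+⟪a,k.b⟫-⟪k.a,b⟫}(s) k` (`Heis.mul_expCurve`, `Heis.conj_expCurve`; group law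
alone), the transported derivative `hasSKDerivAt_centerModel_conj_expCurve`, and — by UNIQUENESS of Weil-topology
derivatives (file #1 `HasSKDerivAt.unique`; `𝓢` is Hausdorff) — the `Ad`-covariance of the derived representation
`repCLM_schrodingerGen_repCLM_inv : ρ_m(k) (dρ_m(a,b,c) (ρ_m(k⁻¹) Φ)) = dρ_m(a,b,c+⟪a,k.b⟫-⟪k.a,b⟫) Φ`
(the integrated form of pv14-g6's CCR `schrodingerGen_commutator`, obtained without differentiating under an integral
and without commuting unbounded operators).

HONEST LABEL.  Transport creates no derivative: the input `hD` (one curve, one insertion) is exactly the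
Schwartz-topology statement of GAPS pv02g7-K4 / pv11g9-A7 on the CONSTRUCTED model, to be supplied at `Σ₁₂` by the
pv14 lineage's flow engines once a model with `U(W_b)` acting through `ω` exists; the Lie-algebra fact
`𝔭_b = Ad(T_b)·ℝX₁` belongs to the printed `𝔲(1,1)` dictionary (pv12 / pv06 lineages) and is NOT formalised here.

PRINT inputs: none beyond the imported modules ([We64] n° 39 joint continuity enters through `actionContinuous`).
-/

noncomputable section

open Filter Topology
open scoped SchwartzMap RealInnerProductSpace FourierTransform

namespace HodgeCM
namespace WeilThetaModel

variable {GU : Type} [Group GU] [TopologicalSpace GU] {ΓU : Subgroup GU}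
variable {G : Type} [Group G] [TopologicalSpace G] {Γ : Subgroup G}
variable {M : WeilThetaModel GU ΓU G Γ} [M.LinearStr]

/-! ## §1  Transport along a conjugation law -/

/-- **Conjugation transport.**  If `ω(e s)Φ = ω(k)(ω(a s)(ω(k')Φ))` for all `s` (e.g. `e s = k·a(s)·k'` and `ω`
multiplicative on these elements) and `s ↦ ω(a s)(ω(k')Φ)` has `SK`-derivative `X` at `s₀`, then `s ↦ ω(e s)Φ` has
`SK`-derivative `ω(k)X` at `s₀`.  (`k' = k⁻¹` is file #1's `hasSKDerivAt_omg_conj`; here `k, k'` are arbitrary.) -/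
theorem hasSKDerivAt_omg_conj' {k k' : G} {a e : ℝ → G} {Φ X : M.SK} {s₀ : ℝ}
    (he : ∀ s, M.omg (e s) Φ = M.omg k (M.omg (a s) (M.omg k' Φ)))
    (h : M.HasSKDerivAt (fun s => M.omg (a s) (M.omg k' Φ)) X s₀) :
    M.HasSKDerivAt (fun s => M.omg (e s) Φ) (M.omg k X) s₀ :=
  (h.omg k).congr he

/-- Conjugation transport with a rescaled parameter: `ω(e s)Φ = ω(k)(ω(a (c*s))(ω(k')Φ))`, derivative `c • ω(k)X`
(`X` the derivative of `s ↦ ω(a s)(ω(k')Φ)` at `c * s₀`). -/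
theorem hasSKDerivAt_omg_conj_rescale [ContinuousSMul ℂ M.W.SX] {k k' : G} {a e : ℝ → G} {Φ X : M.SK} (c : ℝ)
    {s₀ : ℝ} (he : ∀ s, M.omg (e s) Φ = M.omg k (M.omg (a (c * s)) (M.omg k' Φ)))
    (h : M.HasSKDerivAt (fun s => M.omg (a s) (M.omg k' Φ)) X (c * s₀)) :
    M.HasSKDerivAt (fun s => M.omg (e s) Φ) (c • M.omg k X) s₀ := by
  have h₁ : M.HasSKDerivAt (fun s => M.omg (a (c * s)) (M.omg k' Φ)) (c • X) s₀ := h.comp_const_mul c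
  have h₂ := h₁.omg k
  refine (h₂.congr he).congr_deriv ?_
  rw [← Complex.coe_smul c (M.omg k X), ← Complex.coe_smul c X, M.omg_smul]

/-! ## §2  Transport between equivariantly related insertion maps -/

section Insert

variable {F₀ F₁ : Type*}

/-- **Transport of the `smooth` clause.**  Two insertion maps `ins₀ : F₀ → 𝒮^κ`, `ins₁ : F₁ → 𝒮^κ` related by
`ω(k) ∘ ins₀ = ins₁ ∘ A`, `ω(k') ∘ ins₁ = ins₀ ∘ A'`; a curve `e` conjugate to `a` through `k, k'`
(`ω(e s) = ω(k) ∘ ω(a s) ∘ ω(k')`); and `s ↦ ω(a s)(ins₀ ψ)` differentiable at `s₀` with derivative `ins₀ (D ψ)` for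
every `ψ`.  Then `s ↦ ω(e s)(ins₁ φ)` is differentiable at `s₀` with derivative `ins₁ (A (D (A' φ)))`, for every `φ`.
(Typical uses: `ins₀ = ins₁ = ins f`, `k = ι_T t`, `k' = ι_T t⁻¹`, `A = ω_T t`, `A' = ω_T t⁻¹` — a torus-conjugate
direction; or `ins₁ = ins f'`, `ins₀ = ins f` with `Φ_{f'} = ω_f(h)Φ_f`, `k = h`, `k' = h⁻¹`, `A = A' = id` — another
finite datum.)  No linearity and no topology on `F₀, F₁` is used. -/
theorem hasSKDerivAt_omg_transport (ins₀ : F₀ → M.SK) (ins₁ : F₁ → M.SK) {k k' : G} {A : F₀ → F₁}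
    {A' : F₁ → F₀} (hk : ∀ ψ, M.omg k (ins₀ ψ) = ins₁ (A ψ)) (hk' : ∀ φ, M.omg k' (ins₁ φ) = ins₀ (A' φ))
    {a e : ℝ → G} (he : ∀ s Φ, M.omg (e s) Φ = M.omg k (M.omg (a s) (M.omg k' Φ))) {D : F₀ → F₀} {s₀ : ℝ}
    (hD : ∀ ψ, M.HasSKDerivAt (fun s => M.omg (a s) (ins₀ ψ)) (ins₀ (D ψ)) s₀) (φ : F₁) :
    M.HasSKDerivAt (fun s => M.omg (e s) (ins₁ φ)) (ins₁ (A (D (A' φ)))) s₀ := by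
  have h : M.HasSKDerivAt (fun s => M.omg (a s) (M.omg k' (ins₁ φ))) (ins₀ (D (A' φ))) s₀ := by
    simpa only [hk'] using hD (A' φ)
  exact (hasSKDerivAt_omg_conj' (he · (ins₁ φ)) h).congr_deriv (hk _).symm

/-- Transport of the `smooth` clause with a rescaled parameter (direction `c · Ad(k) X`): `e` conjugate to
`s ↦ a (c * s)`; derivative `c • ins₁ (A (D (A' φ)))`, the input derivative being taken at `c * s₀`. -/
theorem hasSKDerivAt_omg_transport_rescale [ContinuousSMul ℂ M.W.SX] (ins₀ : F₀ → M.SK) (ins₁ : F₁ → M.SK)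
    {k k' : G} {A : F₀ → F₁} {A' : F₁ → F₀} (hk : ∀ ψ, M.omg k (ins₀ ψ) = ins₁ (A ψ))
    (hk' : ∀ φ, M.omg k' (ins₁ φ) = ins₀ (A' φ)) {a e : ℝ → G} (c : ℝ)
    (he : ∀ s Φ, M.omg (e s) Φ = M.omg k (M.omg (a (c * s)) (M.omg k' Φ))) {D : F₀ → F₀} {s₀ : ℝ}
    (hD : ∀ ψ, M.HasSKDerivAt (fun s => M.omg (a s) (ins₀ ψ)) (ins₀ (D ψ)) (c * s₀)) (φ : F₁) :
    M.HasSKDerivAt (fun s => M.omg (e s) (ins₁ φ)) (c • ins₁ (A (D (A' φ)))) s₀ := by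
  have h : M.HasSKDerivAt (fun s => M.omg (a s) (M.omg k' (ins₁ φ))) (ins₀ (D (A' φ))) (c * s₀) := by
    simpa only [hk'] using hD (A' φ)
  have h₂ := hasSKDerivAt_omg_conj_rescale c (he · (ins₁ φ)) h
  rw [hk] at h₂
  exact h₂

/-- The same-insertion special case (a torus-conjugate direction): `ins₀ = ins₁ = ins`, `ω(k) ∘ ins = ins ∘ A`,
`ω(k') ∘ ins = ins ∘ A'`. -/
theorem hasSKDerivAt_omg_transport_self (ins : F₀ → M.SK) {k k' : G} {A A' : F₀ → F₀}
    (hk : ∀ ψ, M.omg k (ins ψ) = ins (A ψ)) (hk' : ∀ φ, M.omg k' (ins φ) = ins (A' φ)) {a e : ℝ → G}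
    (he : ∀ s Φ, M.omg (e s) Φ = M.omg k (M.omg (a s) (M.omg k' Φ))) {D : F₀ → F₀} {s₀ : ℝ}
    (hD : ∀ ψ, M.HasSKDerivAt (fun s => M.omg (a s) (ins ψ)) (ins (D ψ)) s₀) (φ : F₀) :
    M.HasSKDerivAt (fun s => M.omg (e s) (ins φ)) (ins (A (D (A' φ)))) s₀ :=
  hasSKDerivAt_omg_transport ins ins hk hk' he hD φ

/-- The other-datum special case: `ω(k) ∘ ins₀ = ins₁`, `ω(k') ∘ ins₁ = ins₀` (e.g. `k' = k⁻¹`, `k` commuting with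
the curve: `ω(e s) = ω(k) ω(e s) ω(k⁻¹)`); the derivative map `D` is unchanged. -/
theorem hasSKDerivAt_omg_transport_datum (ins₀ ins₁ : F₀ → M.SK) {k k' : G}
    (hk : ∀ ψ, M.omg k (ins₀ ψ) = ins₁ ψ) (hk' : ∀ φ, M.omg k' (ins₁ φ) = ins₀ φ) {a e : ℝ → G}
    (he : ∀ s Φ, M.omg (e s) Φ = M.omg k (M.omg (a s) (M.omg k' Φ))) {D : F₀ → F₀} {s₀ : ℝ}
    (hD : ∀ ψ, M.HasSKDerivAt (fun s => M.omg (a s) (ins₀ ψ)) (ins₀ (D ψ)) s₀) (φ : F₀) :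
    M.HasSKDerivAt (fun s => M.omg (e s) (ins₁ φ)) (ins₁ (D φ)) s₀ :=
  hasSKDerivAt_omg_transport (A := id) (A' := id) ins₀ ins₁ hk hk' he hD φ

/-- Transport for a model on which `ω` is multiplicative (`ω(gh) = ω(g)ω(h)` on `𝒮^κ`, e.g. the centre model) along
the conjugate one-parameter family `s ↦ k · a(s) · k⁻¹`: the conjugation law `he` is then automatic. -/
theorem hasSKDerivAt_omg_transport_of_mul (hmul : ∀ g h (Φ : M.SK), M.omg (g * h) Φ = M.omg g (M.omg h Φ))
    (ins₀ : F₀ → M.SK) (ins₁ : F₁ → M.SK) (k : G) {A : F₀ → F₁} {A' : F₁ → F₀}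
    (hk : ∀ ψ, M.omg k (ins₀ ψ) = ins₁ (A ψ)) (hk' : ∀ φ, M.omg k⁻¹ (ins₁ φ) = ins₀ (A' φ)) (a : ℝ → G)
    {D : F₀ → F₀} {s₀ : ℝ} (hD : ∀ ψ, M.HasSKDerivAt (fun s => M.omg (a s) (ins₀ ψ)) (ins₀ (D ψ)) s₀) (φ : F₁) :
    M.HasSKDerivAt (fun s => M.omg (k * a s * k⁻¹) (ins₁ φ)) (ins₁ (A (D (A' φ)))) s₀ :=
  hasSKDerivAt_omg_transport ins₀ ins₁ hk hk' (e := fun s => k * a s * k⁻¹)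
    (fun s Φ => by rw [hmul, hmul]) hD φ

end Insert

/-! ## §3  The literal `smooth`-clause form -/

section SmoothClause

variable {F₀ F₁ : Type*}

/-- Transport stated on the literal `smooth` clause of the seam-S4 analytic side (difference quotients with the
coerced scalar `((s:ℝ):ℂ)⁻¹` at `s = 0`; pv02-g7 `hasSKDerivAt_zero_iff_tendsto_coe_smul`). -/
theorem smooth_clause_transport (ins₀ : F₀ → M.SK) (ins₁ : F₁ → M.SK) {k k' : G} {A : F₀ → F₁}
    {A' : F₁ → F₀} (hk : ∀ ψ, M.omg k (ins₀ ψ) = ins₁ (A ψ)) (hk' : ∀ φ, M.omg k' (ins₁ φ) = ins₀ (A' φ))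
    {a e : ℝ → G} (he : ∀ s Φ, M.omg (e s) Φ = M.omg k (M.omg (a s) (M.omg k' Φ))) {D : F₀ → F₀}
    (hD : ∀ ψ, Tendsto (fun s : ℝ => ((s : ℝ) : ℂ)⁻¹ • (M.omg (a s) (ins₀ ψ) - M.omg (a 0) (ins₀ ψ)))
      (𝓝[≠] 0) (𝓝 (ins₀ (D ψ)))) (φ : F₁) :
    Tendsto (fun s : ℝ => ((s : ℝ) : ℂ)⁻¹ • (M.omg (e s) (ins₁ φ) - M.omg (e 0) (ins₁ φ)))
      (𝓝[≠] 0) (𝓝 (ins₁ (A (D (A' φ))))) := by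
  rw [← hasSKDerivAt_zero_iff_tendsto_coe_smul]
  exact hasSKDerivAt_omg_transport ins₀ ins₁ hk hk' he
    (fun ψ => hasSKDerivAt_zero_iff_tendsto_coe_smul.2 (hD ψ)) φ

end SmoothClause

end WeilThetaModel

/-! ## §4  The centre model: conjugation of one-parameter subgroups of `Heis V` and `Ad`-covariance of `dρ_m` -/

namespace SchwartzWeil

namespace Heis

variable {V : Type} [NormedAddCommGroup V] [InnerProductSpace ℝ V]

/-- **Commutation law of a group element past a one-parameter subgroup of the Heisenberg group**:
`k · γ_{a,b,c}(s) = γ_{a,b,c+⟪a,k.b⟫-⟪k.a,b⟫}(s) · k` (group law only: the central parameter shifts by the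
symplectic pairing). -/
theorem mul_expCurve (k : Heis V) (a b : V) (c s : ℝ) :
    k * expCurve a b c s = expCurve a b (c + (⟪a, k.b⟫ - ⟪k.a, b⟫)) s * k := by
  ext : 1
  · simp [add_comm]
  · simp [add_comm]
  · simp only [mul_u, expCurve_u, expCurve_a, expCurve_b, real_inner_smul_left, real_inner_smul_right]
    rw [mul_comm (𝐞 _) k.u, mul_assoc, mul_assoc, ← AddChar.map_add_eq_mul, ← AddChar.map_add_eq_mul]
    exact congrArg (fun r : ℝ => k.u * (𝐞 r : Circle)) (by ring)

/-- **Conjugation law of one-parameter subgroups of the Heisenberg group**: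
`k · γ_{a,b,c}(s) · k⁻¹ = γ_{a,b,c+⟪a,k.b⟫-⟪k.a,b⟫}(s)` — the conjugate of a one-parameter subgroup is the
one-parameter subgroup with shifted central parameter. -/
theorem conj_expCurve (k : Heis V) (a b : V) (c s : ℝ) :
    k * expCurve a b c s * k⁻¹ = expCurve a b (c + (⟪a, k.b⟫ - ⟪k.a, b⟫)) s := by
  rw [mul_expCurve, mul_inv_cancel_right]

end Heis

namespace HeisenbergKernel

variable (V : Type) [NormedAddCommGroup V] [InnerProductSpace ℝ V] [FiniteDimensional ℝ V] [MeasurableSpace V]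
  [BorelSpace V] (L : Submodule ℤ V) [DiscreteTopology L] (m : ℤ) (Γz : Subgroup Circle)
  (hΓz : ∀ z ∈ Γz, z ^ m = 1)

/-- The conjugation law of §1 on the centre model: `ω(k γ(s) k⁻¹)Φ = ω(k)(ω(γ s)(ω(k⁻¹)Φ))` (multiplicativity of
`ω = ρ_m`, file #1 `centerModel_omg_mul`). -/
theorem centerModel_omg_conj (k : Heis V) (a b : V) (c s : ℝ) (Φ : (centerModel V L m Γz hΓz).SK) :
    (centerModel V L m Γz hΓz).omg (k * Heis.expCurve a b c s * k⁻¹) Φ =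
      (centerModel V L m Γz hΓz).omg k ((centerModel V L m Γz hΓz).omg (Heis.expCurve a b c s)
        ((centerModel V L m Γz hΓz).omg k⁻¹ Φ)) := by
  rw [centerModel_omg_mul, centerModel_omg_mul]

/-- **Transported derivative on the centre model**: `s ↦ ω(k γ_{a,b,c}(s) k⁻¹)Φ` has `SK`-derivative
`ω(k) ⟨dρ_m(a,b,c)(ρ_m(k⁻¹)Φ), _⟩` at `0` (§1 applied to pv02-g7 / pv14-g6's derivative of `ρ_m` along `γ_{a,b,c}`). -/
theorem hasSKDerivAt_centerModel_conj_expCurve (k : Heis V) (a b : V) (c : ℝ) (Φ : 𝓢(V, ℂ)) :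
    (centerModel V L m Γz hΓz).HasSKDerivAt
      (fun s => (centerModel V L m Γz hΓz).omg (k * Heis.expCurve a b c s * k⁻¹) ⟨Φ, Set.mem_univ _⟩)
      ((centerModel V L m Γz hΓz).omg k
        ⟨schrodingerGen V m a b c (repCLM V m k⁻¹ Φ), Set.mem_univ _⟩) 0 := by
  have hΦ : (⟨repCLM V m k⁻¹ Φ, Set.mem_univ _⟩ : (centerModel V L m Γz hΓz).SK) =
      (centerModel V L m Γz hΓz).omg k⁻¹ ⟨Φ, Set.mem_univ _⟩ :=
    Subtype.ext (by rw [centerModel_omg])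
  have h := hasSKDerivAt_centerModel_expCurve' V L m Γz hΓz a b c (repCLM V m k⁻¹ Φ)
  rw [hΦ] at h
  exact WeilThetaModel.hasSKDerivAt_omg_conj'
    (fun s => centerModel_omg_conj V L m Γz hΓz k a b c s ⟨Φ, Set.mem_univ _⟩) h

/-- The same derivative computed through the conjugation law of `Heis V` (`Heis.conj_expCurve`): it is
`⟨dρ_m(a,b,c+⟪a,k.b⟫-⟪k.a,b⟫)Φ, _⟩`. -/
theorem hasSKDerivAt_centerModel_conj_expCurve' (k : Heis V) (a b : V) (c : ℝ) (Φ : 𝓢(V, ℂ)) :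
    (centerModel V L m Γz hΓz).HasSKDerivAt
      (fun s => (centerModel V L m Γz hΓz).omg (k * Heis.expCurve a b c s * k⁻¹) ⟨Φ, Set.mem_univ _⟩)
      ⟨schrodingerGen V m a b (c + (⟪a, k.b⟫ - ⟪k.a, b⟫)) Φ, Set.mem_univ _⟩ 0 :=
  (hasSKDerivAt_centerModel_expCurve' V L m Γz hΓz a b _ Φ).congr
    (fun s => by rw [Heis.conj_expCurve])

/-- **`Ad`-covariance of the derived Schrödinger representation**, from UNIQUENESS of Weil-topology derivatives
(file #1 `HasSKDerivAt.unique`; `𝓢(V, ℂ)` is Hausdorff):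
`ρ_m(k) (dρ_m(a,b,c) (ρ_m(k⁻¹) Φ)) = dρ_m(a,b,c+⟪a,k.b⟫-⟪k.a,b⟫) Φ` for every Schwartz `Φ` — the integrated form of
the canonical commutation relations. -/
theorem repCLM_schrodingerGen_repCLM_inv (k : Heis V) (a b : V) (c : ℝ) (Φ : 𝓢(V, ℂ)) :
    repCLM V m k (schrodingerGen V m a b c (repCLM V m k⁻¹ Φ)) =
      schrodingerGen V m a b (c + (⟪a, k.b⟫ - ⟪k.a, b⟫)) Φ := by
  let M := centerModel V (⊥ : Submodule ℤ V) m ⊥ (fun z hz => by rw [Subgroup.mem_bot.mp hz, one_zpow])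
  have h₁ := hasSKDerivAt_centerModel_conj_expCurve V (⊥ : Submodule ℤ V) m ⊥
    (fun z hz => by rw [Subgroup.mem_bot.mp hz, one_zpow]) k a b c Φ
  have h₂ := hasSKDerivAt_centerModel_conj_expCurve' V (⊥ : Submodule ℤ V) m ⊥
    (fun z hz => by rw [Subgroup.mem_bot.mp hz, one_zpow]) k a b c Φ
  have h := congrArg Subtype.val (h₁.unique h₂)
  rw [centerModel_omg] at h
  exact h

/-- `Ad`-covariance, conjugation on the other side: `ρ_m(k⁻¹) (dρ_m(a,b,c) (ρ_m(k) Φ)) = dρ_m(a,b,c-⟪a,k.b⟫+⟪k.a,b⟫) Φ`. -/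
theorem repCLM_inv_schrodingerGen_repCLM (k : Heis V) (a b : V) (c : ℝ) (Φ : 𝓢(V, ℂ)) :
    repCLM V m k⁻¹ (schrodingerGen V m a b c (repCLM V m k Φ)) =
      schrodingerGen V m a b (c - ⟪a, k.b⟫ + ⟪k.a, b⟫) Φ := by
  have h := repCLM_schrodingerGen_repCLM_inv V m k⁻¹ a b c Φ
  rw [inv_inv] at h
  rw [h, Heis.inv_a, Heis.inv_b, inner_neg_right, inner_neg_left]
  ring_nf

end HeisenbergKernel

end SchwartzWeil

end HodgeCM
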